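import Literature.Analysis.Matrix.KreissMatrixTheoremHolds
import HarnessLib

/-!
# The Kreiss Matrix Theorem for `e^{tA}`, right inequality `sup_t ‖e^{tA}‖ ≤ e N 𝒦(A)` — the named fact `KreissMatrixTheoremExp` discharged

Topic `Analysis/Matrix`, namespace `Literature.Analysis.Matrix.KreissMatrix`; theorems only (no definitions, no
named facts, no instances, no notation).

The named fact `Literature.Analysis.Matrix.KreissMatrix.KreissMatrixTheoremExp` (`KreissMatrixTheorem.lean`) is
L. N. Trefethen, M. Embree, *Spectra and Pseudospectra*, §18 **Theorem 18.5**, right inequality of (18.8): on a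
complex normed space of finite dimension `N`, a Kreiss bound `K` with respect to the LEFT HALF-PLANE (every `z` with
`Re z > 0` is in the resolvent set and `(Re z)‖(z − T)⁻¹‖ ≤ K`) gives `‖e^{tT}‖ ≤ e N K` for every `t > 0`.

PRINTED PROOF (p. 183, chunks p0156–p0157 of the held text): «The proof is essentially as before; we give just a
sketch» — the resolvent integral `v* e^{tA} u = (2πi)⁻¹ ∫_G e^{tz} r(z) dz`, integration by parts, the contour
`G = t⁻¹ + iℝ` and Spijker's lemma.  THE PROOF HERE takes a shorter road in the tree (recorded deviation): instead
of the improper integral over the vertical line we REDUCE Theorem 18.5 to Theorem 18.1 (the tree's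
`KreissMatrixTheorem_holds`) through the backward-Euler (resolvent) substitution.  For `h > 0` put
`B_h = (1 − hT)⁻¹`; for `|ζ| > 1` the exact identity
`(ζ − B_h)⁻¹ = ζ⁻¹ (1 + (ζh)⁻¹ (z − T)⁻¹)`, `z = (1 − ζ⁻¹)/h`, `Re z ≥ (1 − |ζ|⁻¹)/h > 0`,
and the half-plane bound `‖(z − T)⁻¹‖ ≤ K/Re z` give `(|ζ| − 1)‖(ζ − B_h)⁻¹‖ ≤ (|ζ| − 1 + K)/|ζ| ≤ K` (`K ≥ 1` is
automatic on a nonzero space, `one_le_of_halfPlaneKreissBoundedBy`), i.e. `B_h` has the disc Kreiss bound `K`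
(`kreissBoundedBy_backwardEuler`); hence `‖B_hⁿ‖ ≤ e N K` for all `n` by Theorem 18.1, and
`e^{tT} = lim_n B_{t/n}ⁿ` (the Euler limit with a rate, `‖((1 − a/n)⁻¹)ⁿ − e^{a}‖ ≤ 2‖a‖² e^{2‖a‖}/n`,
`norm_inverse_pow_sub_exp_le`) yields `‖e^{tT}‖ ≤ e N K` (`KreissMatrixTheoremExp_holds`).  The statement
discharged is the book's, unchanged.

## References

* L. N. Trefethen, M. Embree, *Spectra and Pseudospectra*, Princeton University Press, 2005, §18 Theorem 18.5
  (18.8) and its proof sketch p. 183 [TrefethenEmbree2005] (held text `book:trefethennd-spectra-pseudospectra`,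
  chunks p0156–p0157); §18 Theorem 18.1 (the discrete theorem used here).
* R. J. LeVeque, L. N. Trefethen, *On the resolvent condition in the Kreiss matrix theorem*, BIT 24 (1984) 584–591,
  Theorem 2 (the `e^{At}` analogue) [LevequeTrefethen1984].
-/

noncomputable section

namespace Literature.Analysis.Matrix.KreissMatrix

open Complex Metric Set NormedSpace
open scoped Real NNReal ENNReal

/-! ## The Euler limit `(1 − a/n)⁻ⁿ → e^{a}` in a Banach algebra, with an explicit rate -/

section EulerLimit

variable {A : Type*} [NormedRing A] [NormedAlgebra ℂ A] [CompleteSpace A] [NormOneClass A]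

omit [CompleteSpace A] in
/-- `‖exp x‖ ≤ e^{‖x‖}` in a Banach algebra (from the exponential series). [folklore] -/
private theorem norm_exp_le_real_exp (x : A) : ‖exp x‖ ≤ Real.exp ‖x‖ := by
  rw [congrFun (exp_eq_tsum ℂ) x, Real.exp_eq_exp_ℝ, congrFun (exp_eq_tsum ℝ) ‖x‖]
  have hs : Summable fun n : ℕ => ‖((n.factorial : ℂ)⁻¹) • x ^ n‖ := norm_expSeries_summable' x
  have hs' : Summable fun n : ℕ => ((n.factorial : ℝ)⁻¹) • ‖x‖ ^ n :=
    (norm_expSeries_summable' (𝕂 := ℝ) ‖x‖).of_norm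
  refine (norm_tsum_le_tsum_norm hs).trans (Summable.tsum_le_tsum (fun n => ?_) hs hs')
  rw [norm_smul, norm_inv, Complex.norm_natCast, smul_eq_mul]
  exact mul_le_mul_of_nonneg_left (norm_pow_le x n) (by positivity)

/-- For `‖x‖ ≤ 1/2`: `‖(1 − x)⁻¹ − e^{x}‖ ≤ 2‖x‖²` (both power series in `x` agree to first order). [folklore] -/
private theorem norm_inverse_one_sub_sub_exp_le (x : A) (hx : ‖x‖ ≤ 1 / 2) :
    ‖Ring.inverse (1 - x) - exp x‖ ≤ 2 * ‖x‖ ^ 2 := by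
  have hx1 : ‖x‖ < 1 := lt_of_le_of_lt hx (by norm_num)
  have hgeom : HasSum (fun n : ℕ => x ^ n) (Ring.inverse (1 - x)) := by
    rw [← geom_series_eq_inverse x hx1]
    exact (summable_geometric_of_norm_lt_one hx1).hasSum
  have hexp : HasSum (fun n : ℕ => ((n.factorial : ℂ)⁻¹) • x ^ n) (exp x) := by
    rw [congrFun (exp_eq_tsum ℂ) x]
    exact (norm_expSeries_summable' x).of_norm.hasSum
  have hdiff : HasSum (fun n : ℕ => x ^ n - ((n.factorial : ℂ)⁻¹) • x ^ n)
      (Ring.inverse (1 - x) - exp x) := hgeom.sub hexp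
  -- the majorant `∑_{n ≥ 2} ‖x‖ⁿ = ‖x‖² (1 − ‖x‖)⁻¹`, written as a shifted geometric series
  have hmaj : HasSum (fun n : ℕ => if n < 2 then (0 : ℝ) else ‖x‖ ^ n) (‖x‖ ^ 2 * (1 - ‖x‖)⁻¹) := by
    have hg : HasSum (fun n : ℕ => ‖x‖ ^ 2 * ‖x‖ ^ n) (‖x‖ ^ 2 * (1 - ‖x‖)⁻¹) :=
      (hasSum_geometric_of_lt_one (norm_nonneg _) hx1).mul_left _
    refine (hasSum_nat_add_iff' 2).1 ?_
    have h0 : (∑ i ∈ Finset.range 2, if i < 2 then (0 : ℝ) else ‖x‖ ^ i) = 0 :=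
      Finset.sum_eq_zero fun i hi => by rw [if_pos (Finset.mem_range.1 hi)]
    rw [h0, sub_zero]
    have hfun : (fun n : ℕ => if n + 2 < 2 then (0 : ℝ) else ‖x‖ ^ (n + 2)) = fun n => ‖x‖ ^ 2 * ‖x‖ ^ n := by
      funext n
      rw [if_neg (by omega), pow_add, mul_comm]
    show HasSum (fun n : ℕ => if n + 2 < 2 then (0 : ℝ) else ‖x‖ ^ (n + 2)) (‖x‖ ^ 2 * (1 - ‖x‖)⁻¹)
    rw [hfun]
    exact hg
  -- termwise comparison: the terms `n = 0, 1` vanish, the others have norm `≤ ‖x‖ⁿ`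
  have hterm : ∀ n : ℕ, ‖x ^ n - ((n.factorial : ℂ)⁻¹) • x ^ n‖ ≤ if n < 2 then (0 : ℝ) else ‖x‖ ^ n := by
    intro n
    split_ifs with hn
    · interval_cases n <;> simp
    · have h1 : x ^ n - ((n.factorial : ℂ)⁻¹) • x ^ n = (1 - ((n.factorial : ℂ)⁻¹)) • x ^ n := by
        rw [sub_smul, one_smul]
      have hf : (1 : ℝ) ≤ n.factorial := by exact_mod_cast Nat.one_le_iff_ne_zero.2 (Nat.factorial_ne_zero n)
      have hc : ‖(1 - ((n.factorial : ℂ)⁻¹) : ℂ)‖ ≤ 1 := by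
        have : (1 - ((n.factorial : ℂ)⁻¹) : ℂ) = (((1 - (n.factorial : ℝ)⁻¹ : ℝ)) : ℂ) := by push_cast; ring
        rw [this, Complex.norm_real, Real.norm_eq_abs, abs_of_nonneg (by
          rw [sub_nonneg]; exact inv_le_one_of_one_le₀ hf)]
        have : (0 : ℝ) ≤ (n.factorial : ℝ)⁻¹ := by positivity
        linarith
      rw [h1, norm_smul]
      calc ‖(1 - ((n.factorial : ℂ)⁻¹) : ℂ)‖ * ‖x ^ n‖ ≤ 1 * ‖x‖ ^ n :=
            mul_le_mul hc (norm_pow_le x n) (norm_nonneg _) zero_le_one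
        _ = ‖x‖ ^ n := one_mul _
  calc ‖Ring.inverse (1 - x) - exp x‖ ≤ ‖x‖ ^ 2 * (1 - ‖x‖)⁻¹ := hdiff.norm_le_of_bounded hmaj hterm
    _ ≤ ‖x‖ ^ 2 * 2 := by
        refine mul_le_mul_of_nonneg_left ?_ (by positivity)
        rw [inv_le_comm₀ (by linarith) (by norm_num)]
        linarith
    _ = 2 * ‖x‖ ^ 2 := by ring

/-- **The Euler limit with a rate**: for `n ≥ 1` with `‖a‖ ≤ n/2`,
`‖((1 − a/n)⁻¹)ⁿ − e^{a}‖ ≤ 2‖a‖² e^{2‖a‖} / n`. [folklore] -/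
private theorem norm_inverse_pow_sub_exp_le (a : A) {n : ℕ} (hn : 0 < n) (ha : ‖a‖ ≤ n / 2) :
    ‖Ring.inverse (1 - (n : ℂ)⁻¹ • a) ^ n - exp a‖ ≤ 2 * ‖a‖ ^ 2 * Real.exp (2 * ‖a‖) / n := by
  have hn' : (0 : ℝ) < n := by exact_mod_cast hn
  set x : A := (n : ℂ)⁻¹ • a with hx_def
  have hxn : ‖x‖ = ‖a‖ / n := by
    rw [hx_def, norm_smul, norm_inv, Complex.norm_natCast, div_eq_inv_mul]
  have hx2 : ‖x‖ ≤ 1 / 2 := by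
    rw [hxn, div_le_iff₀ hn']
    linarith
  have hx1 : ‖x‖ < 1 := lt_of_le_of_lt hx2 (by norm_num)
  have hx0 : 0 ≤ ‖x‖ := norm_nonneg _
  set F : A := Ring.inverse (1 - x) with hF_def
  set G : A := exp x with hG_def
  -- `F` and `G` commute (both commute with `x`)
  have hFunit : F = ↑(Units.oneSub x hx1)⁻¹ := by rw [hF_def, NormedRing.inverse_one_sub x hx1]
  have hxF : Commute x F := by
    rw [hFunit]
    exact ((Commute.one_right x).sub_right (Commute.refl x)).units_inv_right
  have hFG : Commute F G := hxF.symm.exp_right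
  -- `Gⁿ = e^{a}`
  letI : NormedAlgebra ℚ A := NormedAlgebra.restrictScalars ℚ ℂ A
  have hGn : G ^ n = exp a := by
    rw [hG_def, ← NormedSpace.exp_nsmul, hx_def, ← Nat.cast_smul_eq_nsmul ℂ, smul_smul,
      mul_inv_cancel₀ (by exact_mod_cast hn.ne'), one_smul]
  -- norms of `F`, `G` are at most `e^{2‖x‖}`
  have hGle : ‖G‖ ≤ Real.exp (2 * ‖x‖) :=
    (norm_exp_le_real_exp x).trans (Real.exp_le_exp.2 (by linarith))
  have hFle : ‖F‖ ≤ Real.exp (2 * ‖x‖) := by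
    have hgeomF : HasSum (fun k : ℕ => x ^ k) F := by
      rw [hF_def, ← geom_series_eq_inverse x hx1]
      exact (summable_geometric_of_norm_lt_one hx1).hasSum
    have h1 : ‖F‖ ≤ (1 - ‖x‖)⁻¹ :=
      hgeomF.norm_le_of_bounded (hasSum_geometric_of_lt_one hx0 hx1) fun k => norm_pow_le x k
    have h2 : (1 - ‖x‖)⁻¹ ≤ 1 + 2 * ‖x‖ := by
      rw [inv_le_iff_one_le_mul₀' (by linarith)]
      nlinarith
    have h3 : 1 + 2 * ‖x‖ ≤ Real.exp (2 * ‖x‖) := by linarith [Real.add_one_le_exp (2 * ‖x‖)]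
    exact h1.trans (h2.trans h3)
  have hM1 : 1 ≤ Real.exp (2 * ‖x‖) := Real.one_le_exp (by positivity)
  have hMn : Real.exp (2 * ‖x‖) ^ n = Real.exp (2 * ‖a‖) := by
    rw [← Real.exp_nat_mul, hxn]
    congr 1
    field_simp
  -- telescoping: `Fⁿ − Gⁿ = (∑ Fⁱ G^{n−1−i}) (F − G)`
  have htel : F ^ n - G ^ n = (∑ i ∈ Finset.range n, F ^ i * G ^ (n - 1 - i)) * (F - G) :=
    (hFG.geom_sum₂_mul n).symm
  have hS : ‖∑ i ∈ Finset.range n, F ^ i * G ^ (n - 1 - i)‖ ≤ n * Real.exp (2 * ‖a‖) := by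
    calc ‖∑ i ∈ Finset.range n, F ^ i * G ^ (n - 1 - i)‖
        ≤ ∑ i ∈ Finset.range n, ‖F ^ i * G ^ (n - 1 - i)‖ := norm_sum_le _ _
      _ ≤ ∑ i ∈ Finset.range n, Real.exp (2 * ‖a‖) := by
          refine Finset.sum_le_sum fun i hi => ?_
          have hi' : i < n := Finset.mem_range.1 hi
          calc ‖F ^ i * G ^ (n - 1 - i)‖ ≤ ‖F ^ i‖ * ‖G ^ (n - 1 - i)‖ := norm_mul_le _ _
            _ ≤ ‖F‖ ^ i * ‖G‖ ^ (n - 1 - i) :=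
                mul_le_mul (norm_pow_le F i) (norm_pow_le G _) (norm_nonneg _) (by positivity)
            _ ≤ Real.exp (2 * ‖x‖) ^ i * Real.exp (2 * ‖x‖) ^ (n - 1 - i) := by
                gcongr
            _ = Real.exp (2 * ‖x‖) ^ (n - 1) := by
                rw [← pow_add]
                congr 1
                omega
            _ ≤ Real.exp (2 * ‖x‖) ^ n := pow_le_pow_right₀ hM1 (Nat.sub_le n 1)
            _ = Real.exp (2 * ‖a‖) := hMn
      _ = n * Real.exp (2 * ‖a‖) := by rw [Finset.sum_const, Finset.card_range, nsmul_eq_mul]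
  have hFG2 : ‖F - G‖ ≤ 2 * ‖x‖ ^ 2 := norm_inverse_one_sub_sub_exp_le x hx2
  rw [← hGn, htel]
  calc ‖(∑ i ∈ Finset.range n, F ^ i * G ^ (n - 1 - i)) * (F - G)‖
      ≤ ‖∑ i ∈ Finset.range n, F ^ i * G ^ (n - 1 - i)‖ * ‖F - G‖ := norm_mul_le _ _
    _ ≤ (n * Real.exp (2 * ‖a‖)) * (2 * ‖x‖ ^ 2) :=
        mul_le_mul hS hFG2 (norm_nonneg _) (by positivity)
    _ = 2 * ‖a‖ ^ 2 * Real.exp (2 * ‖a‖) / n := by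
        rw [hxn]
        field_simp

end EulerLimit

/-! ## The backward-Euler substitution: a half-plane Kreiss bound for `T` is a disc Kreiss bound for `(1 − hT)⁻¹` -/

section BackwardEuler

variable {E : Type} [NormedAddCommGroup E] [NormedSpace ℂ E]

/-- On a nonzero space a half-plane Kreiss bound is at least `1` (let `z = x → +∞` in `x‖(x − T)⁻¹‖ ≤ K`).
[cite: TrefethenEmbree2005, §18 Theorem 18.5 (18.8), left inequality `𝒦(A) ≤ sup ‖e^{tA}‖` with `t → 0`; §14] -/
theorem one_le_of_halfPlaneKreissBoundedBy [Nontrivial E] {T : E →L[ℂ] E} {K : ℝ}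
    (hK : HalfPlaneKreissBoundedBy T K) : 1 ≤ K := by
  by_contra hlt
  push Not at hlt
  have hK0 : 0 ≤ K := by
    have h := (hK 1 (by simp)).2
    simp only [one_re, one_mul] at h
    exact (norm_nonneg _).trans h
  -- take `x = (‖T‖ + 1)/(1 − K)` on the positive real axis
  set x : ℝ := (‖T‖ + 1) / (1 - K) with hx_def
  have h1K : 0 < 1 - K := by linarith
  have hx0 : 0 < x := by rw [hx_def]; positivity
  have hxre : 0 < ((x : ℂ)).re := by simpa using hx0
  obtain ⟨hres, hbound⟩ := hK (x : ℂ) hxre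
  rw [ofReal_re] at hbound
  obtain ⟨U, hU⟩ := spectrum.mem_resolventSet_iff.1 hres
  have hRU : resolvent T (x : ℂ) = (↑U⁻¹ : E →L[ℂ] E) := by
    rw [resolvent, ← hU, Ring.inverse_unit]
  -- `1 = ‖U U⁻¹‖ ≤ ‖U‖ ‖U⁻¹‖ ≤ (x + ‖T‖) ‖U⁻¹‖`
  have hUle : ‖(U : E →L[ℂ] E)‖ ≤ x + ‖T‖ := by
    rw [hU, Algebra.algebraMap_eq_smul_one]
    calc ‖(x : ℂ) • (1 : E →L[ℂ] E) - T‖ ≤ ‖(x : ℂ) • (1 : E →L[ℂ] E)‖ + ‖T‖ := norm_sub_le _ _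
      _ = x + ‖T‖ := by rw [norm_smul, norm_one, mul_one, Complex.norm_real, Real.norm_eq_abs, abs_of_pos hx0]
  have hone : (1 : ℝ) ≤ (x + ‖T‖) * (K / x) := by
    calc (1 : ℝ) = ‖(U : E →L[ℂ] E) * ↑U⁻¹‖ := by rw [Units.mul_inv, norm_one]
      _ ≤ ‖(U : E →L[ℂ] E)‖ * ‖(↑U⁻¹ : E →L[ℂ] E)‖ := norm_mul_le _ _
      _ ≤ (x + ‖T‖) * (K / x) := by
          refine mul_le_mul hUle ?_ (norm_nonneg _) (by positivity)
          rw [← hRU, le_div_iff₀ hx0, mul_comm]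
          exact hbound
  have hx1 : x * (1 - K) = ‖T‖ + 1 := by
    rw [hx_def]
    field_simp
  have h2 : x ≤ (x + ‖T‖) * K := by
    have := mul_le_mul_of_nonneg_left hone hx0.le
    rw [mul_one] at this
    calc x ≤ x * ((x + ‖T‖) * (K / x)) := this
      _ = (x + ‖T‖) * K := by field_simp
  have hT0 : 0 ≤ ‖T‖ := norm_nonneg _
  nlinarith

/-- Under a half-plane Kreiss bound, `1 − hT` is invertible for every `h > 0` (`h⁻¹` lies in the resolvent set).
[cite: TrefethenEmbree2005, §18 Theorem 18.5] -/
theorem isUnit_one_sub_real_smul_of_halfPlaneKreissBoundedBy {T : E →L[ℂ] E} {K : ℝ}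
    (hK : HalfPlaneKreissBoundedBy T K) {h : ℝ} (hh : 0 < h) : IsUnit (1 - (h : ℂ) • T) := by
  have hre : 0 < ((h : ℂ)⁻¹).re := by
    rw [← ofReal_inv, ofReal_re]
    exact inv_pos.2 hh
  obtain ⟨U, hU⟩ := spectrum.mem_resolventSet_iff.1 (hK _ hre).1
  have hh0 : (h : ℂ) ≠ 0 := by exact_mod_cast hh.ne'
  have h1 : 1 - (h : ℂ) • T = (h : ℂ) • (algebraMap ℂ (E →L[ℂ] E) (h : ℂ)⁻¹ - T) := by
    rw [smul_sub, Algebra.algebraMap_eq_smul_one, smul_smul, mul_inv_cancel₀ hh0, one_smul]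
  rw [h1, ← hU]
  refine isUnit_iff_exists.2 ⟨(h : ℂ)⁻¹ • (↑U⁻¹ : E →L[ℂ] E), ?_, ?_⟩
  · rw [smul_mul_smul_comm, mul_inv_cancel₀ hh0, Units.mul_inv, one_smul]
  · rw [smul_mul_smul_comm, inv_mul_cancel₀ hh0, Units.inv_mul, one_smul]

/-- **The resolvent of the backward-Euler operator.**  For `h > 0`, `B = (1 − hT)⁻¹` and `|ζ| > 1`, with
`z = (1 − ζ⁻¹)/h` (so `Re z > 0`) and `R = (z − T)⁻¹`: `ζ − B` is invertible and
`(ζ − B)⁻¹ = ζ⁻¹ (1 + (ζh)⁻¹ R)`. [cite: TrefethenEmbree2005, §18 Theorem 18.5 (reduction to Theorem 18.1)] -/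
theorem resolvent_backwardEuler {T : E →L[ℂ] E} {K : ℝ} (hK : HalfPlaneKreissBoundedBy T K)
    {h : ℝ} (hh : 0 < h) {ζ : ℂ} (hζ : 1 < ‖ζ‖) :
    ζ ∈ resolventSet ℂ (Ring.inverse (1 - (h : ℂ) • T)) ∧
      resolvent (Ring.inverse (1 - (h : ℂ) • T)) ζ =
        ζ⁻¹ • (1 + (ζ * h)⁻¹ • resolvent T ((1 - ζ⁻¹) / h)) := by
  have hζ0 : ζ ≠ 0 := by
    rintro rfl
    rw [norm_zero] at hζ
    linarith
  have hh0 : (h : ℂ) ≠ 0 := by exact_mod_cast hh.ne'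
  set z : ℂ := (1 - ζ⁻¹) / h with hz_def
  have hzre : 0 < z.re := by
    rw [hz_def, div_ofReal_re, sub_re, one_re]
    refine div_pos ?_ hh
    have h1 : (ζ⁻¹).re ≤ ‖ζ⁻¹‖ := re_le_norm _
    rw [norm_inv] at h1
    have h2 : ‖ζ‖⁻¹ < 1 := inv_lt_one_of_one_lt₀ hζ
    linarith
  obtain ⟨hzres, -⟩ := hK z hzre
  -- `S = z − T`, `R = S⁻¹`, `c = (ζh)⁻¹`, `W = 1 − hT`, `B = W⁻¹`
  set S : E →L[ℂ] E := algebraMap ℂ (E →L[ℂ] E) z - T with hS_def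
  have hSunit : IsUnit S := spectrum.mem_resolventSet_iff.1 hzres
  set R : E →L[ℂ] E := resolvent T z with hR_def
  have hR : R = Ring.inverse S := rfl
  have hSR : S * R = 1 := by rw [hR, Ring.mul_inverse_cancel _ hSunit]
  have hRS : R * S = 1 := by rw [hR, Ring.inverse_mul_cancel _ hSunit]
  set c : ℂ := (ζ * h)⁻¹ with hc_def
  set W : E →L[ℂ] E := 1 - (h : ℂ) • T with hW_def
  have hWunit : IsUnit W := isUnit_one_sub_real_smul_of_halfPlaneKreissBoundedBy hK hh
  set B : E →L[ℂ] E := Ring.inverse W with hB_def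
  have hWB : W * B = 1 := by rw [hB_def, Ring.mul_inverse_cancel _ hWunit]
  have hBW : B * W = 1 := by rw [hB_def, Ring.inverse_mul_cancel _ hWunit]
  -- `W = h (S + c)` because `h (z + c) = 1`, and `ζ c = h⁻¹`
  have hzc : (h : ℂ) * (z + c) = 1 := by
    rw [hz_def, hc_def]
    field_simp
    ring
  have hζc : ζ * c = (h : ℂ)⁻¹ := by
    rw [hc_def, mul_inv, ← mul_assoc, mul_inv_cancel₀ hζ0, one_mul]
  have hWS : W = (h : ℂ) • (S + c • (1 : E →L[ℂ] E)) := by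
    have e1 : S + c • (1 : E →L[ℂ] E) = (z + c) • (1 : E →L[ℂ] E) - T := by
      rw [hS_def, Algebra.algebraMap_eq_smul_one, add_smul]
      abel
    rw [e1, smul_sub, smul_smul, hzc, one_smul]
  have hScW : S + c • (1 : E →L[ℂ] E) = (h : ℂ)⁻¹ • W := by
    rw [hWS, smul_smul, inv_mul_cancel₀ hh0, one_smul]
  -- `(S + c) R = 1 + cR = R (S + c)`
  have hSc : (S + c • (1 : E →L[ℂ] E)) * R = 1 + c • R := by
    rw [add_mul, hSR, smul_mul_assoc, one_mul]
  have hcS : R * (S + c • (1 : E →L[ℂ] E)) = 1 + c • R := by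
    rw [mul_add, hRS, mul_smul_comm, mul_one]
  -- `B (1 + cR) = h⁻¹ R = (1 + cR) B`
  have hB1 : B * (1 + c • R) = (h : ℂ)⁻¹ • R := by
    rw [← hSc, ← mul_assoc, hScW, mul_smul_comm, hBW, smul_mul_assoc, one_mul]
  have h1B : (1 + c • R) * B = (h : ℂ)⁻¹ • R := by
    rw [← hcS, mul_assoc, hScW, smul_mul_assoc, hWB, mul_smul_comm, mul_one]
  -- the two-sided inverse `U = ζ⁻¹ (1 + cR)` of `V = ζ − B`
  set V : E →L[ℂ] E := algebraMap ℂ (E →L[ℂ] E) ζ - B with hV_def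
  set U : E →L[ℂ] E := ζ⁻¹ • (1 + c • R) with hU_def
  have hVU : V * U = 1 := by
    rw [hV_def, hU_def, Algebra.algebraMap_eq_smul_one, mul_smul_comm, sub_mul, smul_mul_assoc, one_mul, hB1,
      smul_add, smul_smul, hζc, add_sub_cancel_right, smul_smul, inv_mul_cancel₀ hζ0, one_smul]
  have hUV : U * V = 1 := by
    rw [hV_def, hU_def, Algebra.algebraMap_eq_smul_one, smul_mul_assoc, mul_sub, mul_smul_comm, mul_one, h1B,
      smul_add, smul_smul, hζc, add_sub_cancel_right, smul_smul, inv_mul_cancel₀ hζ0, one_smul]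
  set u : (E →L[ℂ] E)ˣ := ⟨V, U, hVU, hUV⟩ with hu_def
  have hVunit : IsUnit V := ⟨u, rfl⟩
  refine ⟨spectrum.mem_resolventSet_iff.2 hVunit, ?_⟩
  change Ring.inverse V = U
  rw [show V = (u : E →L[ℂ] E) from rfl, Ring.inverse_unit]
  rfl

/-- **A half-plane Kreiss bound for `T` is a disc Kreiss bound, with the same constant, for every backward-Euler
operator `(1 − hT)⁻¹`, `h > 0`:** from `resolvent_backwardEuler`, `‖(z − T)⁻¹‖ ≤ K/Re z ≤ K h|ζ|/(|ζ| − 1)`, and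
`(|ζ| − 1 + K)/|ζ| ≤ K` (as `K ≥ 1`). [cite: TrefethenEmbree2005, §18 Theorem 18.5 (reduction to Theorem 18.1)] -/
theorem kreissBoundedBy_backwardEuler [Nontrivial E] {T : E →L[ℂ] E} {K : ℝ}
    (hK : HalfPlaneKreissBoundedBy T K) {h : ℝ} (hh : 0 < h) :
    KreissBoundedBy (Ring.inverse (1 - (h : ℂ) • T)) K := by
  intro ζ hζ
  obtain ⟨hres, hformula⟩ := resolvent_backwardEuler hK hh hζ
  refine ⟨hres, ?_⟩
  rw [hformula]
  have hK1 : 1 ≤ K := one_le_of_halfPlaneKreissBoundedBy hK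
  set ρ : ℝ := ‖ζ‖ with hρ
  have hρ1 : 1 < ρ := hζ
  have hρ0 : 0 < ρ := by linarith
  have hζ0 : ζ ≠ 0 := by
    rintro rfl
    rw [hρ, norm_zero] at hρ1
    linarith
  set z : ℂ := (1 - ζ⁻¹) / h with hz_def
  -- `Re z ≥ (1 − ρ⁻¹)/h = (ρ − 1)/(ρh) > 0`
  have hzre : (ρ - 1) / (ρ * h) ≤ z.re := by
    rw [hz_def, div_ofReal_re, sub_re, one_re]
    have h1 : (ζ⁻¹).re ≤ ‖ζ⁻¹‖ := re_le_norm _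
    rw [norm_inv, ← hρ] at h1
    have : (ρ - 1) / (ρ * h) = (1 - ρ⁻¹) / h := by field_simp
    rw [this]
    exact div_le_div_of_nonneg_right (by linarith) hh.le
  have hzre0 : 0 < (ρ - 1) / (ρ * h) := by positivity
  have hzre' : 0 < z.re := lt_of_lt_of_le hzre0 hzre
  have hRz : ‖resolvent T z‖ ≤ K * (ρ * h) / (ρ - 1) := by
    have hb := (hK z hzre').2
    have h1 : ‖resolvent T z‖ ≤ K / z.re := by
      rw [le_div_iff₀ hzre', mul_comm]
      exact hb
    refine h1.trans ?_
    calc K / z.re ≤ K / ((ρ - 1) / (ρ * h)) := div_le_div_of_nonneg_left (by linarith) hzre0 hzre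
      _ = K * (ρ * h) / (ρ - 1) := by rw [div_div_eq_mul_div]
  have hc : ‖(ζ * h)⁻¹‖ = (ρ * h)⁻¹ := by
    rw [norm_inv, norm_mul, Complex.norm_real, Real.norm_eq_abs, abs_of_pos hh]
  have hcR : ‖(ζ * h)⁻¹‖ * ‖resolvent T z‖ ≤ K / (ρ - 1) := by
    rw [hc]
    calc (ρ * h)⁻¹ * ‖resolvent T z‖ ≤ (ρ * h)⁻¹ * (K * (ρ * h) / (ρ - 1)) := by gcongr
      _ = K / (ρ - 1) := by field_simp
  have hnorm : ‖ζ⁻¹ • ((1 : E →L[ℂ] E) + (ζ * h)⁻¹ • resolvent T z)‖ ≤ ρ⁻¹ * (1 + K / (ρ - 1)) := by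
    rw [norm_smul, norm_inv, ← hρ]
    refine mul_le_mul_of_nonneg_left ?_ (by positivity)
    calc ‖(1 : E →L[ℂ] E) + (ζ * h)⁻¹ • resolvent T z‖ ≤ ‖(1 : E →L[ℂ] E)‖ + ‖(ζ * h)⁻¹ • resolvent T z‖ :=
          norm_add_le _ _
      _ = 1 + ‖(ζ * h)⁻¹‖ * ‖resolvent T z‖ := by rw [norm_one, norm_smul]
      _ ≤ 1 + K / (ρ - 1) := by gcongr
  calc (‖ζ‖ - 1) * ‖ζ⁻¹ • ((1 : E →L[ℂ] E) + (ζ * h)⁻¹ • resolvent T z)‖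
      ≤ (ρ - 1) * (ρ⁻¹ * (1 + K / (ρ - 1))) := by
        rw [← hρ]
        exact mul_le_mul_of_nonneg_left hnorm (by linarith)
    _ = (ρ - 1 + K) / ρ := by
        have hρ1' : ρ - 1 ≠ 0 := by linarith
        field_simp
    _ ≤ K := by
        rw [div_le_iff₀ hρ0]
        nlinarith

end BackwardEuler

/-! ## The theorem -/

section Exponential

/-- **The Kreiss Matrix Theorem for `e^{tA}` (Theorem 18.5), right-hand inequality `‖e^{tT}‖ ≤ e N 𝒦(T)`**, the
named fact `KreissMatrixTheoremExp` discharged: on a complex normed space of finite dimension `N`, a Kreiss bound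
`K` with respect to the left half-plane gives `‖e^{tT}‖ ≤ e N K` for every `t > 0`.  Via Theorem 18.1 applied to
the backward-Euler operators `(1 − (t/n)T)⁻¹` and the Euler limit `((1 − (t/n)T)⁻¹)ⁿ → e^{tT}`.
[cite: TrefethenEmbree2005, §18 Theorem 18.5 (18.8), right inequality] -/
theorem KreissMatrixTheoremExp_holds : KreissMatrixTheoremExp := by
  intro E _ _ _ T K hK t ht
  rcases subsingleton_or_nontrivial E with hE | hE
  · have h0 : Module.finrank ℂ E = 0 := Module.finrank_zero_of_subsingleton
    rw [h0, Nat.cast_zero, mul_zero, zero_mul]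
    exact le_of_eq (ContinuousLinearMap.opNorm_subsingleton _)
  haveI : CompleteSpace E := FiniteDimensional.complete ℂ E
  set N : ℕ := Module.finrank ℂ E with hN
  have hK1 : 1 ≤ K := one_le_of_halfPlaneKreissBoundedBy hK
  have hK0 : 0 ≤ K := zero_le_one.trans hK1
  set a : E →L[ℂ] E := (t : ℂ) • T with ha_def
  have hta : t • T = a := by
    rw [ha_def]
    ext v
    exact (Complex.coe_smul t (T v)).symm
  rw [hta]
  -- the backward-Euler powers are bounded by `e N K` (Theorem 18.1)
  have hpow : ∀ n : ℕ, 0 < n → ‖Ring.inverse (1 - (n : ℂ)⁻¹ • a) ^ n‖ ≤ Real.exp 1 * N * K := by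
    intro n hn
    have hh : 0 < t / n := div_pos ht (by exact_mod_cast hn)
    have hB := kreissBoundedBy_backwardEuler hK hh
    have heq : ((t / n : ℝ) : ℂ) • T = (n : ℂ)⁻¹ • a := by
      rw [ha_def, smul_smul]
      congr 1
      push_cast
      ring
    rw [heq] at hB
    exact (powerBoundedBy_iff _ _).1 (KreissMatrixTheorem_holds E _ K hB) n
  -- the Euler limit: `‖e^{a}‖ ≤ e N K + 2‖a‖²e^{2‖a‖}/n` for all large `n`
  set C : ℝ := 2 * ‖a‖ ^ 2 * Real.exp (2 * ‖a‖) with hC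
  have hC0 : 0 ≤ C := by positivity
  refine le_of_forall_pos_le_add fun ε hε => ?_
  obtain ⟨n, hn⟩ := exists_nat_gt (max (2 * ‖a‖) (C / ε))
  have hn2 : 2 * ‖a‖ < n := lt_of_le_of_lt (le_max_left _ _) hn
  have hnC : C / ε < n := lt_of_le_of_lt (le_max_right _ _) hn
  have hn0' : (0 : ℝ) < n := lt_of_le_of_lt (by positivity) hn2
  have hn0 : 0 < n := by exact_mod_cast hn0'
  have hEuler := norm_inverse_pow_sub_exp_le a hn0 (by linarith)
  have hCn : C / n ≤ ε := by
    rw [div_le_iff₀ hn0']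
    rw [div_lt_iff₀ hε] at hnC
    linarith
  calc ‖exp a‖ = ‖Ring.inverse (1 - (n : ℂ)⁻¹ • a) ^ n - (Ring.inverse (1 - (n : ℂ)⁻¹ • a) ^ n - exp a)‖ := by
        rw [sub_sub_cancel]
    _ ≤ ‖Ring.inverse (1 - (n : ℂ)⁻¹ • a) ^ n‖ + ‖Ring.inverse (1 - (n : ℂ)⁻¹ • a) ^ n - exp a‖ :=
        norm_sub_le _ _
    _ ≤ Real.exp 1 * N * K + C / n := add_le_add (hpow n hn0) (by rw [hC]; exact hEuler)
    _ ≤ Real.exp 1 * N * K + ε := by gcongr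

end Exponential

end Literature.Analysis.Matrix.KreissMatrix
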